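import Literature.MathematicalPhysics.QuantumFieldTheory.QCDFlavourSymmetry
import Summits.QuantumFields.QCD.Theorems.QuarksNoInfraredClauseTorusHalfSpectrumStubSelectionRule
import Summits.QuantumFields.QCD.Theorems.QuarksNoInfraredClauseTorusHalfSpectrumStubHomogeneousReduction
import Summits.QuantumFields.QCD.Theorems.QuarksNoInfraredClauseTorusHalfSpectrumStubDetDiracMatrixPos
import Summits.QuantumFields.QCD.Theorems.QuarksNoInfraredClauseTorusHalfSpectrumStubConjugateHeavyPathwise
import Summits.QuantumFields.QCD.Theorems.QuarksNoInfraredClauseTorusHalfSpectrumStubConjugateHeavy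
import HarnessLib

/-!
# The heavy-mass corner of the torus half-spectrum lemma `TorusHalfSpectrum` — proved outright

Support file for the crux `Summit.QuantumFields.QCD.Theses.QuarksNoInfraredClause.TorusHalfSpectrum`
(item stmt-QuantumFields-9508, line `registered` = `Cruxes/TorusHalfSpectrum/Lines/birth.lean`), lead c3
(`prover-line-stmt-QuantumFields-9508-c3-0`, 2026-08-17).

`TorusHalfSpectrum` says: along a scheme, FLAVOUR-NEUTRAL clustering at rate `2Δ` (per pair, in the quantifier shape
of `HasLatticeMassGap`) implies ALL-PAIR clustering at rate `Δ`.  For schemes in the HEAVY-MASS CORNER — one positive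
lower bound `m₀` on all bare Wilson masses eventually (hopping parameters `κ_f ≤ 1/(2m₀+8) < 1/8`) — this implication
holds outright, with none of the crux's other hypotheses (`0 < b₀`, asymptotic scaling, branch condition) and without
the threshold uniformisation that the light window would need: reduce to flavour-homogeneous pairs (Peter–Weyl for the
flavour torus, `HomogeneousReduction.stub_homogeneous_reduction`); doubly neutral pairs are the hypothesis at the weaker
rate; pairs with `q_A + q_B ≠ 0` vanish identically (exact selection rule, `SelectionRule.stub_selection_rule`); conjugate
charged pairs `(q, −q)`, `q ≠ 0`, cluster at EVERY rate in the heavy corner (`ConjugateHeavy.stub_conjugate_heavy`, fed by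
determinant positivity `DetDiracMatrixPos.stub_det_diracMatrix_pos` and the configuration-wise hopping bound
`ConjugateHeavyPathwise.stub_conjugate_heavy_pathwise`).  So the open content of the crux is exactly the light window.
-/

noncomputable section

namespace Summit.QuantumFields.QCD.Cruxes.TorusHalfSpectrum.Birth.HeavyCornerHalfSpectrum

open scoped BigOperators
open Filter
open Literature.MathematicalPhysics.QuantumFieldTheory

/-- **`TorusHalfSpectrum` in the heavy-mass corner, unconditionally** (registered sub-goal `stub_heavyCorner_halfSpectrum`).  For every `N_f`, every scheme `sch` with
`∃ m₀ > 0, ∀ f, m₀ ≤ m_f(k)` eventually, and every `Δ > 0`: per-pair flavour-neutral clustering at rate `2Δ`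
(`HasNeutralLatticeMassGap (2Δ)`) implies `HasLatticeMassGap Δ` (all pairs: flavoured mesons, baryons, …). -/
theorem stub_heavyCorner_halfSpectrum :
    ∀ (Nf : ℕ) (sch : QCDScheme Nf) (Δ : ℝ), 0 < Δ →
      (∃ m₀ : ℝ, 0 < m₀ ∧ ∀ fl : Fin Nf, ∀ᶠ k in atTop, m₀ ≤ sch.mq fl k) →
        sch.HasNeutralLatticeMassGap (2 * Δ) → sch.HasLatticeMassGap Δ := by
  intro Nf sch Δ hΔ hheavy hN
  refine HomogeneousReduction.stub_homogeneous_reduction Nf sch Δ fun R R' A B qA qB hA hB => ?_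
  by_cases hq : qA = 0 ∧ qB = 0
  · -- both neutral: the hypothesis at the weaker rate `Δ ≤ 2Δ`
    obtain ⟨hqA, hqB⟩ := hq
    subst hqA
    subst hqB
    have hA0 : A.IsFlavourNeutral := fun t ht U => by simpa using hA t ht U
    have hB0 : B.IsFlavourNeutral := fun t ht U => by simpa using hB t ht U
    exact (hN.mono (by linarith)) R R' A B hA0 hB0
  · by_cases hsum : qA + qB = 0
    · -- conjugate charged pair: the heavy corner
      have hqB : qB = -qA := eq_neg_of_add_eq_zero_right hsum
      have hqA : qA ≠ 0 := by
        rcases not_and_or.mp hq with h | h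
        · exact h
        · intro h0
          exact h (by rw [hqB, h0, neg_zero])
      subst hqB
      exact ConjugateHeavy.stub_conjugate_heavy DetDiracMatrixPos.stub_det_diracMatrix_pos
        ConjugateHeavyPathwise.stub_conjugate_heavy_pathwise Nf sch Δ hΔ hheavy R R' A B qA hA hB hqA
    · -- total charge non-zero: the exact selection rule
      exact SelectionRule.stub_selection_rule Nf sch Δ R R' A B qA qB hA hB hsum

/-- **The crux's implication, verbatim, for heavy-corner schemes**: with the crux's own hypothesis list
(`0 < Δ`, `0 < b₀`, asymptotic scaling, branch condition, per-pair neutral clustering at `2Δ` in the inlined form of the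
route file) and the heavy corner, `sch.HasLatticeMassGap Δ`.  The three scheme hypotheses are not used. -/
theorem torusHalfSpectrum_of_heavyCorner (Nf : ℕ) (sch : QCDScheme Nf) (Δ : ℝ) (hΔ : 0 < Δ)
    (_hb : 0 < betaCoeff₀ Nf) (_hAS : sch.HasAsymptoticScaling)
    (_hbranch : ∀ fl : Fin Nf, ∀ᶠ k in atTop, -1 < sch.mq fl k)
    (hheavy : ∃ m₀ : ℝ, 0 < m₀ ∧ ∀ fl : Fin Nf, ∀ᶠ k in atTop, m₀ ≤ sch.mq fl k)
    (hN : ∀ (R R' : ℕ) (A : QCDLatticeObservable Nf R) (B : QCDLatticeObservable Nf R'),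
      (∀ t : Fin Nf → ℂ, (∀ f, t f ≠ 0) → ∀ U,
        ExteriorAlgebra.map (LinearMap.pi fun w : BoxFermiIdx Nf R ⊕ₗ BoxFermiIdx Nf R =>
          (match ofLex w with
            | Sum.inl i => (t (boxQuarkEquiv.symm i).1)⁻¹
            | Sum.inr i => t (boxQuarkEquiv.symm i).1) • LinearMap.proj w) (A.F U) = A.F U) →
      (∀ t : Fin Nf → ℂ, (∀ f, t f ≠ 0) → ∀ U,
        ExteriorAlgebra.map (LinearMap.pi fun w : BoxFermiIdx Nf R' ⊕ₗ BoxFermiIdx Nf R' =>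
          (match ofLex w with
            | Sum.inl i => (t (boxQuarkEquiv.symm i).1)⁻¹
            | Sum.inr i => t (boxQuarkEquiv.symm i).1) • LinearMap.proj w) (B.F U) = B.F U) →
      ∃ C : ℝ, ∀ᶠ k in atTop, ∀ S : ℕ, sch.L k ≤ S → ∀ n : ℕ, n ≤ S →
        ‖qcdLatticeConnectedCorr (sch.β k) (2 * S + 1) (fun fl => sch.mq fl k) A B n‖ ≤
          C * Real.exp (-(2 * Δ * (sch.a k * n)))) :
    sch.HasLatticeMassGap Δ :=
  stub_heavyCorner_halfSpectrum Nf sch Δ hΔ hheavy hN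

end Summit.QuantumFields.QCD.Cruxes.TorusHalfSpectrum.Birth.HeavyCornerHalfSpectrum

end
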